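import Summits.KontsevichZagierPeriods.Zeta5Search.Barrier.ConeGammaSkeletonCoverBoxE42
import Summits.KontsevichZagierPeriods.Zeta5Search.Barrier.ConeGammaSkeletonCoverBoxE36
import Summits.KontsevichZagierPeriods.Zeta5Search.Barrier.ConeGammaSkeletonCoverBoxE33
import Summits.KontsevichZagierPeriods.Zeta5Search.Barrier.ConeGammaSkeletonCoverBoxE30
import Summits.KontsevichZagierPeriods.Zeta5Search.Barrier.ConeGammaSkeletonCoverBoxL66
import Summits.KontsevichZagierPeriods.Zeta5Search.Barrier.ConeGammaSkeletonCoverBoxP45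
import Summits.KontsevichZagierPeriods.Zeta5Search.Barrier.ConeGammaSkeletonCoverBoxP41
import Summits.KontsevichZagierPeriods.Zeta5Search.Barrier.ConeGammaSkeletonCoverBoxP240
import Summits.KontsevichZagierPeriods.Zeta5Search.Barrier.ConeGammaFarSliceBoxesRec
import Summits.KontsevichZagierPeriods.Zeta5Search.Barrier.ConeGammaFarSliceBoxesFlag
import Summits.KontsevichZagierPeriods.Zeta5Search.Barrier.ConeGammaFarSliceBoxesTstar
import Summits.KontsevichZagierPeriods.Zeta5Search.Barrier.ConeGammaFarSliceBoxesT75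

/-!
# ζ(5) search — BARRIER: THE HOT SKELETON IN ONE KERNEL TUBE — A FIRST COVER (the union of twelve r = 1/100 boxes)

HONEST FRAMING (cell `pub-zeta5`): systematic search; no irrationality claim unless kernel-certified. MODEL objects under Brown–Zudilin's
(28)+(30) accounting ([BZ22] = arXiv:2210.03391; (28) observed, not proved): the rate `gamma` of `ConeGammaRates`. WHAT THIS FILE SAYS: for every
direction `a` of BZ's closed positive box with `Regular a` (exactly the guard of `ConeSupBound`) whose height-one parameters `t = s/s₀` lie in the
UNION of twelve kernel-certified boxes of half-width 1/100 — cert-2 g36's four tree boxes around t\*, t₇₅, flag, t_rec (γ_box by cert-2 g40's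
`FarSlice.gamma_le_slice_*_100`: 0.9314 / 0.9338 / 0.9269 / 0.9297) and the eight NEW boxes of `ConeGammaSkeletonCoverBox*` centred ON the three hot
lines of the resonance flat 𝔉 = {t_j = 1/3 + m_j c, m = (−4,−2,−1,1,2,4)} (γ_box 0.9285–0.9396) — **`gamma a ≤ 9396/10⁴`** (the MAXIMUM of the twelve
box bounds); and, by exact linear arithmetic over ℚ, that this union CONTAINS the sup-norm tube of radius 1/1250 around EVERY CERTIFIED HOT STRETCH of
the three skeleton lines of 𝔉's window (P2 g14/g15, BARRIER-PLAN ADD. 15/16, `pub-zeta5-p2/g15/skeleton/SKELETON-REPORT.md`): ℓ (`t₁ = 11c/2`) on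
c ∈ [51/2200, 3/88] (= ε ∈ [−1/100, 1/20]), ℓ′ (`t₁ = 1/3 − 7c`) on c ∈ [0.02197, 0.03047], L1 (`t₁ = 1/3 − 5c`) on c ∈ [0.0286, 0.031] — the lines
which carry every vertex of 𝔉's coincidence arrangement with float γ ≥ 0.8695 through height 4, the certified MODEL maximiser t₇₅ = ℓ ∩ ℓ′
(0.8701415 ×2), the 66-class vertex t₆₆ (0.8699526 ×2), t\* (N1's argmax 0.8692362), the plateau, and the flag; t_rec's box rides along.
WHAT IT DOES NOT SAY: it is a COARSE ceiling (0.9396) on a 7-dimensional TUBE — about 60× coarser than P2 g14/g15's sharp 1-D exact-kink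
certificates ON the lines (≤ 0.8703, not kernel) and complementary to them; NOTHING about 𝔉's window off the tube, the cone's supremum (C2 OPEN),
the witness sentence, S-E (CONJECTURED), (TD_A) or `ζ(5)`; no number or sentence of record moves; class-60 words untouched; records in print UNMOVED.
It is the first KERNEL statement about `gamma` on a region selected by the STRUCTURE rather than around single points, assembled from cert-2
g36–g40's instruments used AS THEY STAND. Theory seat cert-2 g41 (item «THE HOT SKELETON IN ONE KERNEL TUBE — A FIRST COVER», INBOX l.9767).
-/

open Set
open Literature.Analysis.ValidatedNumerics.NumericsMP

noncomputable section

namespace Summit.KontsevichZagierPeriods.Zeta5Search.Barrier.ConeGamma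

namespace SkelCover

open LemmaFBox (box)
open LemmaFWinBox (loBox_tstar_100 hiBox_tstar_100 loBox_t75_100 hiBox_t75_100 loBox_flag_100 hiBox_flag_100 loBox_rec_100 hiBox_rec_100)

/-! ### The three hot lines of the resonance flat (height one, `t₀ = 1`) -/

/-- The line ℓ (the ascent line, `t₁ = 11c/2`; t* = ℓ(1/40), t₇₅ = ℓ(2/75)) of 𝔉 at height one, as a function of the flat parameter `c`. -/
def ellPt (c : ℝ) : Fin 8 → ℝ :=
  ![1, 11 / 2 * c, 1 / 3 - 4 * c, 1 / 3 - 2 * c, 1 / 3 - c, 1 / 3 + c, 1 / 3 + 2 * c, 1 / 3 + 4 * c]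

/-- The line ℓ′ (the witness's module line, `t₁ = 1/3 − 7c`; t₇₅ = ℓ′(2/75)) of 𝔉 at height one, as a function of the flat parameter `c`. -/
def ellpPt (c : ℝ) : Fin 8 → ℝ :=
  ![1, 1 / 3 - 7 * c, 1 / 3 - 4 * c, 1 / 3 - 2 * c, 1 / 3 - c, 1 / 3 + c, 1 / 3 + 2 * c, 1 / 3 + 4 * c]

/-- The line L1 (the flag line, `t₁ = 1/3 − 5c`; t₆₆ = L1(1/33), flag = (1/6; 𝔉(1/30)) one lattice step off it) of 𝔉 at height one, as a function of the flat parameter `c`. -/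
def l1Pt (c : ℝ) : Fin 8 → ℝ :=
  ![1, 1 / 3 - 5 * c, 1 / 3 - 4 * c, 1 / 3 - 2 * c, 1 / 3 - c, 1 / 3 + c, 1 / 3 + 2 * c, 1 / 3 + 4 * c]

/-! ### The union of the twelve kernel boxes -/

/-- **The cover**: the union of the twelve kernel-certified boxes of half-width 1/100 (cert-2 g36's `box D lo hi` = `{t | lo_i ≤ D·t_i ≤ hi_i}`):
t\*, t₇₅, flag, t_rec (tree) and the eight new boxes on ℓ, L1, ℓ′. -/
def coverUnion : Set (Fin 8 → ℝ) :=
  box 48000 LemmaFWinBox.loBox_tstar_100 LemmaFWinBox.hiBox_tstar_100 ∪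
  box 15000 LemmaFWinBox.loBox_t75_100 LemmaFWinBox.hiBox_t75_100 ∪
  box 6000 LemmaFWinBox.loBox_flag_100 LemmaFWinBox.hiBox_flag_100 ∪
  box 4100 LemmaFWinBox.loBox_rec_100 LemmaFWinBox.hiBox_rec_100 ∪
  box 8400 loBox_e42_100 hiBox_e42_100 ∪
  box 7200 loBox_e36_100 hiBox_e36_100 ∪
  box 6600 loBox_e33_100 hiBox_e33_100 ∪
  box 6000 loBox_e30_100 hiBox_e30_100 ∪
  box 6600 loBox_l66_100 hiBox_l66_100 ∪
  box 9000 loBox_p45_100 hiBox_p45_100 ∪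
  box 24600 loBox_p41_100 hiBox_p41_100 ∪
  box 48000 loBox_p240_100 hiBox_p240_100

/-- The box around t* (480; 66,112,136,148,172,184,208) is part of the cover. -/
theorem mem_cover_tstar {t : Fin 8 → ℝ} (h : t ∈ box 48000 LemmaFWinBox.loBox_tstar_100 LemmaFWinBox.hiBox_tstar_100) : t ∈ coverUnion := by
  unfold coverUnion; exact Or.inl (Or.inl (Or.inl (Or.inl (Or.inl (Or.inl (Or.inl (Or.inl (Or.inl (Or.inl (Or.inl (h)))))))))))

/-- The box around witness t₇₅ (150; 22,34,42,46,54,58,66) is part of the cover. -/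
theorem mem_cover_t75 {t : Fin 8 → ℝ} (h : t ∈ box 15000 LemmaFWinBox.loBox_t75_100 LemmaFWinBox.hiBox_t75_100) : t ∈ coverUnion := by
  unfold coverUnion; exact Or.inl (Or.inl (Or.inl (Or.inl (Or.inl (Or.inl (Or.inl (Or.inl (Or.inl (Or.inl (Or.inr h))))))))))

/-- The box around flag (60; 10,12,16,18,22,24,28) is part of the cover. -/
theorem mem_cover_flag {t : Fin 8 → ℝ} (h : t ∈ box 6000 LemmaFWinBox.loBox_flag_100 LemmaFWinBox.hiBox_flag_100) : t ∈ coverUnion := by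
  unfold coverUnion; exact Or.inl (Or.inl (Or.inl (Or.inl (Or.inl (Or.inl (Or.inl (Or.inl (Or.inl (Or.inr h)))))))))

/-- The box around BZ record ray t_rec (41; 7,9,11,13,15,17,19) is part of the cover. -/
theorem mem_cover_rec {t : Fin 8 → ℝ} (h : t ∈ box 4100 LemmaFWinBox.loBox_rec_100 LemmaFWinBox.hiBox_rec_100) : t ∈ coverUnion := by
  unfold coverUnion; exact Or.inl (Or.inl (Or.inl (Or.inl (Or.inl (Or.inl (Or.inl (Or.inl (Or.inr h))))))))

/-- The box around ℓ(1/42) (84; 11,20,24,26,30,32,36) is part of the cover. -/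
theorem mem_cover_e42 {t : Fin 8 → ℝ} (h : t ∈ box 8400 loBox_e42_100 hiBox_e42_100) : t ∈ coverUnion := by
  unfold coverUnion; exact Or.inl (Or.inl (Or.inl (Or.inl (Or.inl (Or.inl (Or.inl (Or.inr h)))))))

/-- The box around ℓ(1/36) (72; 11,16,20,22,26,28,32) is part of the cover. -/
theorem mem_cover_e36 {t : Fin 8 → ℝ} (h : t ∈ box 7200 loBox_e36_100 hiBox_e36_100) : t ∈ coverUnion := by
  unfold coverUnion; exact Or.inl (Or.inl (Or.inl (Or.inl (Or.inl (Or.inl (Or.inr h))))))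

/-- The box around ℓ(1/33) (66; 11,14,18,20,24,26,30) is part of the cover. -/
theorem mem_cover_e33 {t : Fin 8 → ℝ} (h : t ∈ box 6600 loBox_e33_100 hiBox_e33_100) : t ∈ coverUnion := by
  unfold coverUnion; exact Or.inl (Or.inl (Or.inl (Or.inl (Or.inl (Or.inr h)))))

/-- The box around ℓ(1/30) (60; 11,12,16,18,22,24,28) is part of the cover. -/
theorem mem_cover_e30 {t : Fin 8 → ℝ} (h : t ∈ box 6000 loBox_e30_100 hiBox_e30_100) : t ∈ coverUnion := by
  unfold coverUnion; exact Or.inl (Or.inl (Or.inl (Or.inl (Or.inr h))))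

/-- The box around t66 = L1(1/33) (66; 12,14,18,20,24,26,30) — the 66-class vertex is part of the cover. -/
theorem mem_cover_l66 {t : Fin 8 → ℝ} (h : t ∈ box 6600 loBox_l66_100 hiBox_l66_100) : t ∈ coverUnion := by
  unfold coverUnion; exact Or.inl (Or.inl (Or.inl (Or.inr h)))

/-- The box around ℓ′(1/45) (90; 16,22,26,28,32,34,38) is part of the cover. -/
theorem mem_cover_p45 {t : Fin 8 → ℝ} (h : t ∈ box 9000 loBox_p45_100 hiBox_p45_100) : t ∈ coverUnion := by
  unfold coverUnion; exact Or.inl (Or.inl (Or.inr h))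

/-- The box around ℓ′(1/41) (246; 40,58,70,76,88,94,106) is part of the cover. -/
theorem mem_cover_p41 {t : Fin 8 → ℝ} (h : t ∈ box 24600 loBox_p41_100 hiBox_p41_100) : t ∈ coverUnion := by
  unfold coverUnion; exact Or.inl (Or.inr h)

/-- The box around ℓ′(7/240) (480; 62,104,132,146,174,188,216) is part of the cover. -/
theorem mem_cover_p240 {t : Fin 8 → ℝ} (h : t ∈ box 48000 loBox_p240_100 hiBox_p240_100) : t ∈ coverUnion := by
  unfold coverUnion; exact Or.inr h

/-! ### The cover theorem -/

/-- **`γ(a) ≤ 9396/10⁴` for every REGULAR direction `a` of the closed positive box whose height-one parameters lie in the cover** —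
the maximum of the twelve kernel box bounds (t\* 0.9314, t₇₅ 0.9338, flag 0.9269, t_rec 0.9297; e42 0.9289, e36 0.9366, e33 0.9305, e30 0.9396, l66 0.9312, p45 0.9296, p41 0.9285, p240 0.9315), each used BY NAME.
MODEL `gamma` of `ConeGammaRates` under BZ (28)+(30) ((28) observed, not proved); a COARSE upper bound on a tube; nothing about the cone's supremum
(C2 OPEN), the sharp 1-D line certificates of record (≤ 0.8703), S-E, (TD_A) or `ζ(5)`. -/
theorem gamma_le_skeleton {a : Dir} (ha : BZBox a) (hreg : Regular a)
    (h : (fun i => sParam a i / sParam a 0) ∈ coverUnion) : gamma a ≤ (9396 : ℝ) / 10000 := by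
  unfold coverUnion at h
  rcases h with ((((((((((h | h) | h) | h) | h) | h) | h) | h) | h) | h) | h) | h
  · exact (FarSlice.gamma_le_slice_tstar_100 ha (fun j => h j.succ) hreg).trans (by norm_num)
  · exact (FarSlice.gamma_le_slice_t75_100 ha (fun j => h j.succ) hreg).trans (by norm_num)
  · exact (FarSlice.gamma_le_slice_flag_100 ha (fun j => h j.succ) hreg).trans (by norm_num)
  · exact (FarSlice.gamma_le_slice_rec_100 ha (fun j => h j.succ) hreg).trans (by norm_num)
  · exact (gamma_le_box_e42_100 ha (fun j => h j.succ) hreg).trans (by norm_num)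
  · exact (gamma_le_box_e36_100 ha (fun j => h j.succ) hreg).trans (by norm_num)
  · exact (gamma_le_box_e33_100 ha (fun j => h j.succ) hreg).trans (by norm_num)
  · exact (gamma_le_box_e30_100 ha (fun j => h j.succ) hreg).trans (by norm_num)
  · exact (gamma_le_box_l66_100 ha (fun j => h j.succ) hreg).trans (by norm_num)
  · exact (gamma_le_box_p45_100 ha (fun j => h j.succ) hreg).trans (by norm_num)
  · exact (gamma_le_box_p41_100 ha (fun j => h j.succ) hreg).trans (by norm_num)
  · exact (gamma_le_box_p240_100 ha (fun j => h j.succ) hreg).trans (by norm_num)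

/-- A point within `ρ` (sup-norm) of `p` lies in the box `D, lo, hi` when `p ± ρ` does, coordinatewise (`t₀ = 1`, `lo₀ = hi₀ = D`). -/
theorem mem_box_of_near {D : ℕ} {lo hi : List ℕ} {t p : Fin 8 → ℝ} {ρ : ℝ}
    (h0 : lo.getD 0 0 = D ∧ hi.getD 0 0 = D) (ht0 : t 0 = 1) (ht : ∀ i : Fin 8, |t i - p i| ≤ ρ)
    (hp : ∀ j : Fin 7, ((lo.getD j.succ 0 : ℕ) : ℝ) ≤ (p j.succ - ρ) * D ∧ (p j.succ + ρ) * D ≤ ((hi.getD j.succ 0 : ℕ) : ℝ)) :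
    t ∈ box D lo hi := by
  intro i
  refine Fin.cases ?_ (fun j => ?_) i
  · simp only [Fin.val_zero, h0.1, h0.2, ht0, one_mul]; exact ⟨le_rfl, le_rfl⟩
  · obtain ⟨h1, h2⟩ := abs_le.mp (ht j.succ)
    obtain ⟨h3, h4⟩ := hp j
    have hD : (0 : ℝ) ≤ D := Nat.cast_nonneg _
    constructor <;> nlinarith

/-! ### The union contains the tube of radius 1/1250 around every certified hot stretch of ℓ, ℓ′, L1 -/

/-- **The cover contains the 1/1250-tube around ℓ on its certified hot stretch ε = 5.5(c − 1/40) ∈ [−1/100, 1/20] (P2 g14's eight stretches)**: every height-one point within sup-distance 1/1250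
of ellPt(c), c in that interval, lies in `coverUnion` (exact rational interval splitting: e42 on [0.02318, 0.02548]; t75 on [0.02548, 0.02834]; e36 on [0.02834, 0.02945]; e33 on [0.02945, 0.03198]; e30 on [0.03198, 0.03409]). -/
theorem mem_union_of_mem_ell {t : Fin 8 → ℝ} {c : ℝ} (hc : (51 / 2200 : ℝ) ≤ c ∧ c ≤ 3 / 88) (ht0 : t 0 = 1)
    (ht : ∀ i : Fin 8, |t i - ellPt c i| ≤ 1 / 1250) : t ∈ coverUnion := by
  obtain ⟨hc1, hc2⟩ := hc
  by_cases hb0 : c ≤ 3679 / 144375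
  · refine mem_cover_e42 (mem_box_of_near (by decide) ht0 ht fun j => ?_)
    fin_cases j <;> simp [ellPt, loBox_e42_100, hiBox_e42_100] <;> constructor <;> linarith
  rw [not_le] at hb0
  by_cases hb1 : c ≤ 1169 / 41250
  · refine mem_cover_t75 (mem_box_of_near (by decide) ht0 ht fun j => ?_)
    fin_cases j <;> simp [ellPt, LemmaFWinBox.loBox_t75_100, LemmaFWinBox.hiBox_t75_100] <;> constructor <;> linarith
  rw [not_le] at hb1
  by_cases hb2 : c ≤ 7289 / 247500
  · refine mem_cover_e36 (mem_box_of_near (by decide) ht0 ht fun j => ?_)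
    fin_cases j <;> simp [ellPt, loBox_e36_100, hiBox_e36_100] <;> constructor <;> linarith
  rw [not_le] at hb2
  by_cases hb3 : c ≤ 1319 / 41250
  · refine mem_cover_e33 (mem_box_of_near (by decide) ht0 ht fun j => ?_)
    fin_cases j <;> simp [ellPt, loBox_e33_100, hiBox_e33_100] <;> constructor <;> linarith
  rw [not_le] at hb3
  refine mem_cover_e30 (mem_box_of_near (by decide) ht0 ht fun j => ?_)
  fin_cases j <;> simp [ellPt, loBox_e30_100, hiBox_e30_100] <;> constructor <;> linarith

/-- **`γ(a) ≤ 9396/10⁴` for every REGULAR direction within sup-distance 1/1250 (height one) of ℓ on ε = 5.5(c − 1/40) ∈ [−1/100, 1/20].** MODEL `gamma` under BZ (28)+(30);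
coarse; the sharp 1-D certificates of record on this line are P2's (not kernel); nothing about the cone's supremum (C2 OPEN). -/
theorem gamma_le_near_ell {a : Dir} (ha : BZBox a) (hreg : Regular a) {c : ℝ} (hc : (51 / 2200 : ℝ) ≤ c ∧ c ≤ 3 / 88)
    (ht : ∀ i : Fin 8, |sParam a i / sParam a 0 - ellPt c i| ≤ 1 / 1250) : gamma a ≤ (9396 : ℝ) / 10000 :=
  gamma_le_skeleton ha hreg (mem_union_of_mem_ell hc (by simp [ha.1.ne']) ht)

/-- **The cover contains the 1/1250-tube around ℓ′ on its certified hot stretch c ∈ [0.02197, 0.03047] (P2 g15: ℓ′'s whole passage of the hot window)**: every height-one point within sup-distance 1/1250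
of ellpPt(c), c in that interval, lies in `coverUnion` (exact rational interval splitting: p45 on [0.02197, 0.02354]; p41 on [0.02354, 0.02570]; t75 on [0.02570, 0.02798]; p240 on [0.02798, 0.03047]). -/
theorem mem_union_of_mem_ellp {t : Fin 8 → ℝ} {c : ℝ} (hc : (2197 / 100000 : ℝ) ≤ c ∧ c ≤ 3047 / 100000) (ht0 : t 0 = 1)
    (ht : ∀ i : Fin 8, |t i - ellpPt c i| ≤ 1 / 1250) : t ∈ coverUnion := by
  obtain ⟨hc1, hc2⟩ := hc
  by_cases hb0 : c ≤ 3707 / 157500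
  · refine mem_cover_p45 (mem_box_of_near (by decide) ht0 ht fun j => ?_)
    fin_cases j <;> simp [ellpPt, loBox_p45_100, hiBox_p45_100] <;> constructor <;> linarith
  rw [not_le] at hb0
  by_cases hb1 : c ≤ 18443 / 717500
  · refine mem_cover_p41 (mem_box_of_near (by decide) ht0 ht fun j => ?_)
    fin_cases j <;> simp [ellpPt, loBox_p41_100, hiBox_p41_100] <;> constructor <;> linarith
  rw [not_le] at hb1
  by_cases hb2 : c ≤ 1469 / 52500
  · refine mem_cover_t75 (mem_box_of_near (by decide) ht0 ht fun j => ?_)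
    fin_cases j <;> simp [ellpPt, LemmaFWinBox.loBox_t75_100, LemmaFWinBox.hiBox_t75_100] <;> constructor <;> linarith
  rw [not_le] at hb2
  refine mem_cover_p240 (mem_box_of_near (by decide) ht0 ht fun j => ?_)
  fin_cases j <;> simp [ellpPt, loBox_p240_100, hiBox_p240_100] <;> constructor <;> linarith

/-- **`γ(a) ≤ 9396/10⁴` for every REGULAR direction within sup-distance 1/1250 (height one) of ℓ′ on c ∈ [0.02197, 0.03047].** MODEL `gamma` under BZ (28)+(30);
coarse; the sharp 1-D certificates of record on this line are P2's (not kernel); nothing about the cone's supremum (C2 OPEN). -/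
theorem gamma_le_near_ellp {a : Dir} (ha : BZBox a) (hreg : Regular a) {c : ℝ} (hc : (2197 / 100000 : ℝ) ≤ c ∧ c ≤ 3047 / 100000)
    (ht : ∀ i : Fin 8, |sParam a i / sParam a 0 - ellpPt c i| ≤ 1 / 1250) : gamma a ≤ (9396 : ℝ) / 10000 :=
  gamma_le_skeleton ha hreg (mem_union_of_mem_ellp hc (by simp [ha.1.ne']) ht)

/-- **The cover contains the 1/1250-tube around L1 on its certified hot stretch c ∈ [0.02860, 0.03100] (P2 g15: L1's hot stretch with the 69-, 171-, 204-, 135- and 66-class vertices)**: every height-one point within sup-distance 1/1250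
of l1Pt(c), c in that interval, lies in `coverUnion` (exact rational interval splitting: l66 on [0.02860, 0.03100]). -/
theorem mem_union_of_mem_L1 {t : Fin 8 → ℝ} {c : ℝ} (hc : (143 / 5000 : ℝ) ≤ c ∧ c ≤ 31 / 1000) (ht0 : t 0 = 1)
    (ht : ∀ i : Fin 8, |t i - l1Pt c i| ≤ 1 / 1250) : t ∈ coverUnion := by
  obtain ⟨hc1, hc2⟩ := hc
  refine mem_cover_l66 (mem_box_of_near (by decide) ht0 ht fun j => ?_)
  fin_cases j <;> simp [l1Pt, loBox_l66_100, hiBox_l66_100] <;> constructor <;> linarith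

/-- **`γ(a) ≤ 9396/10⁴` for every REGULAR direction within sup-distance 1/1250 (height one) of L1 on c ∈ [0.02860, 0.03100].** MODEL `gamma` under BZ (28)+(30);
coarse; the sharp 1-D certificates of record on this line are P2's (not kernel); nothing about the cone's supremum (C2 OPEN). -/
theorem gamma_le_near_L1 {a : Dir} (ha : BZBox a) (hreg : Regular a) {c : ℝ} (hc : (143 / 5000 : ℝ) ≤ c ∧ c ≤ 31 / 1000)
    (ht : ∀ i : Fin 8, |sParam a i / sParam a 0 - l1Pt c i| ≤ 1 / 1250) : gamma a ≤ (9396 : ℝ) / 10000 :=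
  gamma_le_skeleton ha hreg (mem_union_of_mem_L1 hc (by simp [ha.1.ne']) ht)

end SkelCover

end Summit.KontsevichZagierPeriods.Zeta5Search.Barrier.ConeGamma

end
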